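import Summits.ResolutionOfSingularities.ResolutionOfSingularities.Theorems.FrobeniusClosingPatchingRelPerfectQuotientRegularityTools
import Mathlib.RingTheory.RegularLocalRing.Polynomial
import Mathlib.Algebra.MvPolynomial.PDeriv
import Mathlib.Algebra.MvPolynomial.Monad
import HarnessLib

/-!
# [OURS · L1 W4.5(b)] EL♮(3) specimen S10 — the characteristic-free KEY LETTER `M♮ = V(x² + y²z + yz²)`:
# PROMOTION CERTIFICATE «`St²M♮` is regular on every chart» (WIDTH TABLE D5, row D5-6; crux `EquisingularLiftNatThree`,
# stmt-ResolutionOfSingularities-20148)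

NOT a statement of any manuscript; OURS kernel specimen (cell `res-hironaka`, chain w45b, seat res-L1-w45b-lead-1 g16).
AI-written, weaker than expert review. Nothing of [Hironaka2017] is asserted; EL♮(3) is NOT proved here.

THE OBJECT. For the isolated specimen `S10 = V((x²+y²z)² + x⁵ + z⁶ + xy⁸ + x¹⁰ + y¹⁰ + z¹⁰)` the D5 word of record
(desk res-L1-w45b-plan-1 g23, «IMMATURE HOST») carries the key letter `M♮ = V(m)`, `m = x² + y²z + yz²` (res-L1-w45b-idea-1
ROUND 17: a `D₄` point at `x₀`, all coefficients `1`, so the same polynomial is its own lift over any base — `map_keyLetterNat`).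
The letter is IMMATURE during the first two moves (the point step `P` at `x₀` and the carrier round `CAR` along
`L̃ = S ∩ St Π`, `Π = V(x)`) and must be PROMOTED to an ordinary (regular) letter from stage 2 on.  This file is the
commutative algebra of that promotion, over an ARBITRARY commutative base ring `R` with `R[X₀,X₁,X₂]` regular (a field `k`
— the special fibre — or a discrete valuation ring `O` — the model — alike):

* the total-transform identities (pure `ring` facts over any `CommRing`): `m ∘ (P:S.y) = X₁²·st1y`, `m ∘ (P:S.z) = X₂²·st1z`,
  `m ∘ (P:S.x) = X₀²·st1x`; the HOST identities `st1y = X₀·X₀ + (X₂+X₂²)·X₁ ∈ (X₀, X₁)`, `st1z = X₀·X₀ + (X₁²+X₁)·X₂ ∈ (X₀, X₂)`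
  (the carrier `L̃` lies on `St¹M♮`); `st1y ∘ (CAR:E1.x) = X₀·st2yx`, `st1y ∘ (CAR:E1.y) = X₁·st2yy`,
  `st1z ∘ (CAR:E1.x) = X₀·st2zx`, `st1z ∘ (CAR:E1.z) = X₂·st2zz`;
* the MATURE host identities of the later moves: `host_PHI_E1x` (`φ_q ⊂ St²M♮`), `total_PHI_E1x_Ephix/_Ephiz`, `host_SIG_Ephiz`
  (`σ_S ⊂ St³M♮`), `host_SST_Ephix` + `span_pair_SST_Ephix` (`(E_φ, St³M♮) = σ∗` literally);
* **PROMOTION**: the five chart rings of `St²M♮` — `R[X]/(st2yx)`, `R[X]/(st2yy)`, `R[X]/(st2zx)`, `R[X]/(st2zz)` and the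
  untouched far chart `R[X]/(st1x)` — are REGULAR rings, by the tree's Jacobian criterion
  `MvPolynomial.isRegularRing_quotient_of_pderiv` (…FrobeniusClosingPatchingRelPerfectQuotientRegularityTools, Matsumura
  14.2) with the explicit unit certificates `∂₀ st2yx = 1`, `(1+2X₂)·∂₂ st2yy − 4·st2yy + 4X₁·∂₁ st2yy = 1`, `∂₀ st2zx = 1`,
  `(1+2X₁)·∂₁ st2zz − 4·st2zz + 4X₂·∂₀ st2zz = 1`, `st1x − X₀·∂₀ st1x = 1` — valid in EVERY characteristic, `2` included.

Measured counterpart: res-L1-w45b-lead-1 `R17-REPLAY.md` v1.2 §1/§5 (kit j317256: `St^k M♮` regular in all charts, `k ≥ 2`, at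
`p ∈ {2,3,5,7,11,13,10007}`) = res-L1-w45b-idea-1 `KeyPolynomialLettersR17-kit.md` §D.  Chart names are atlas7's.
-/

set_option linter.dupNamespace false -- mandated namespace `Summit.<Summit>.<Problem>` of this single-conjunct summit

noncomputable section

open MvPolynomial

namespace Summit.ResolutionOfSingularities.ResolutionOfSingularities.Cruxes.EquisingularLiftNat.Sections

namespace S10KeyLetter

variable (R : Type) [CommRing R]

/-! ## Notation-free conventions
All statements are DEF-FREE: the polynomials are written out.  `m = X₀² + X₁²X₂ + X₁X₂²` is the key letter `M♮`; the strict transforms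
(atlas7 chart names, indices `0,1,2` = the chart coordinates in order) are
`st1y = X₀² + X₁X₂ + X₁X₂²` (chart `A/S.y`: `x = X₀X₁, y = X₁, z = X₂X₁`), `st1z = X₀² + X₁²X₂ + X₁X₂` (chart `A/S.z`),
`st1x = 1 + X₀X₁²X₂ + X₀X₁X₂²` (far chart `A/S.x`, not met by the carrier), and after `CAR` (centre `(X₀,X₁)` on `S.y`, `(X₀,X₂)` on `S.z`)
`st2yx = X₀ + X₁X₂ + X₁X₂²` (`S.y/E1.x`), `st2yy = X₀²X₁ + X₂ + X₂²` (`S.y/E1.y`), `st2zx = X₀ + X₁²X₂ + X₁X₂` (`S.z/E1.x`),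
`st2zz = X₀²X₂ + X₁² + X₁` (`S.z/E1.z`). -/

/-! ## The letter is its own lift (`supp M♮_O = supp M♮`) -/

/-- [OURS · L1 W4.5b] Under ANY ring map the key letter maps to the key letter (all coefficients are `1`): the model over
`O` and the trace over `k` are the same polynomial. [folklore] -/
theorem map_keyLetterNat {S : Type} [CommRing S] (f : R →+* S) : map f ((X 0 ^ 2 + X 1 ^ 2 * X 2 + X 1 * X 2 ^ 2 : MvPolynomial (Fin 3) R)) = (X 0 ^ 2 + X 1 ^ 2 * X 2 + X 1 * X 2 ^ 2 : MvPolynomial (Fin 3) S) := by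
  simp [map_X]

/-! ## Total-transform and host identities (pure `ring` facts) -/

/-- [OURS · L1 W4.5b] Move `P`, chart `S.y`: `m(X₀X₁, X₁, X₂X₁) = X₁² · st1y`. [folklore] -/
theorem total_P_Sy : bind₁ (![X 0 * X 1, X 1, X 2 * X 1] : Fin 3 → MvPolynomial (Fin 3) R) ((X 0 ^ 2 + X 1 ^ 2 * X 2 + X 1 * X 2 ^ 2 : MvPolynomial (Fin 3) R)) =
    X 1 ^ 2 * (X 0 ^ 2 + X 1 * X 2 + X 1 * X 2 ^ 2 : MvPolynomial (Fin 3) R) := by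
  simp only [map_add, map_pow, map_mul, bind₁_X_right]
  simp only [Matrix.cons_val_zero, Matrix.cons_val_one, Matrix.cons_val_two, Matrix.tail_cons, Matrix.head_cons]
  ring

/-- [OURS · L1 W4.5b] Move `P`, chart `S.z`: `m(X₀X₂, X₁X₂, X₂) = X₂² · st1z`. [folklore] -/
theorem total_P_Sz : bind₁ (![X 0 * X 2, X 1 * X 2, X 2] : Fin 3 → MvPolynomial (Fin 3) R) ((X 0 ^ 2 + X 1 ^ 2 * X 2 + X 1 * X 2 ^ 2 : MvPolynomial (Fin 3) R)) =
    X 2 ^ 2 * (X 0 ^ 2 + X 1 ^ 2 * X 2 + X 1 * X 2 : MvPolynomial (Fin 3) R) := by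
  simp only [map_add, map_pow, map_mul, bind₁_X_right]
  simp only [Matrix.cons_val_zero, Matrix.cons_val_one, Matrix.cons_val_two, Matrix.tail_cons, Matrix.head_cons]
  ring

/-- [OURS · L1 W4.5b] Move `P`, far chart `S.x`: `m(X₀, X₁X₀, X₂X₀) = X₀² · st1x`. [folklore] -/
theorem total_P_Sx : bind₁ (![X 0, X 1 * X 0, X 2 * X 0] : Fin 3 → MvPolynomial (Fin 3) R) ((X 0 ^ 2 + X 1 ^ 2 * X 2 + X 1 * X 2 ^ 2 : MvPolynomial (Fin 3) R)) =
    X 0 ^ 2 * (1 + X 0 * X 1 ^ 2 * X 2 + X 0 * X 1 * X 2 ^ 2 : MvPolynomial (Fin 3) R) := by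
  simp only [map_add, map_pow, map_mul, bind₁_X_right]
  simp only [Matrix.cons_val_zero, Matrix.cons_val_one, Matrix.cons_val_two, Matrix.tail_cons, Matrix.head_cons]
  ring

/-- [OURS · L1 W4.5b] HOST identity at `CAR`, chart `S.y` (shape `host_CAR_Sy` of res-L1-w45b-idea-1 R17 §G): `st1y = X₀·X₀ +
(X₂ + X₂²)·X₁`, so the carrier `L̃ = V(X₀, X₁)` lies on `St¹M♮`, with lowest form `(w + w²)·X₁` along it (`w = X₂`):
order `1`, jump locus `w(w+1)`. [folklore] -/
theorem host_CAR_Sy : (X 0 ^ 2 + X 1 * X 2 + X 1 * X 2 ^ 2 : MvPolynomial (Fin 3) R) = X 0 * X 0 + (X 2 + X 2 ^ 2) * X 1 := by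
  ring

/-- [OURS · L1 W4.5b] `st1y ∈ (X₀, X₁)`: the `CAR` centre lies on the immature host (chart `S.y`). [folklore] -/
theorem st1y_mem_span_carrier : (X 0 ^ 2 + X 1 * X 2 + X 1 * X 2 ^ 2 : MvPolynomial (Fin 3) R) ∈ Ideal.span {(X 0 : MvPolynomial (Fin 3) R), X 1} := by
  rw [host_CAR_Sy]
  exact Ideal.add_mem _ (Ideal.mul_mem_left _ _ (Ideal.subset_span (by simp)))
    (Ideal.mul_mem_left _ _ (Ideal.subset_span (by simp)))

/-- [OURS · L1 W4.5b] HOST identity at `CAR`, chart `S.z`: `st1z = X₀·X₀ + (X₁² + X₁)·X₂`, carrier `V(X₀, X₂)`,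
lowest form `(w² + w)·X₂` (`w = X₁`). [folklore] -/
theorem host_CAR_Sz : (X 0 ^ 2 + X 1 ^ 2 * X 2 + X 1 * X 2 : MvPolynomial (Fin 3) R) = X 0 * X 0 + (X 1 ^ 2 + X 1) * X 2 := by
  ring

/-- [OURS · L1 W4.5b] `st1z ∈ (X₀, X₂)` (chart `S.z`). [folklore] -/
theorem st1z_mem_span_carrier : (X 0 ^ 2 + X 1 ^ 2 * X 2 + X 1 * X 2 : MvPolynomial (Fin 3) R) ∈ Ideal.span {(X 0 : MvPolynomial (Fin 3) R), X 2} := by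
  rw [host_CAR_Sz]
  exact Ideal.add_mem _ (Ideal.mul_mem_left _ _ (Ideal.subset_span (by simp)))
    (Ideal.mul_mem_left _ _ (Ideal.subset_span (by simp)))

/-- [OURS · L1 W4.5b] Move `CAR`, chart `S.y/E1.x` (`X₁ ↦ X₁X₀`, exceptional `X₀`): `st1y(X₀, X₁X₀, X₂) = X₀ · st2yx` —
order exactly `1` along the centre (T-M1-EXACT's equimultiplicity: the quotient `st2yx` is not divisible by `X₀`). [folklore] -/
theorem total_CAR_Sy_E1x : bind₁ (![X 0, X 1 * X 0, X 2] : Fin 3 → MvPolynomial (Fin 3) R) ((X 0 ^ 2 + X 1 * X 2 + X 1 * X 2 ^ 2 : MvPolynomial (Fin 3) R)) = X 0 * (X 0 + X 1 * X 2 + X 1 * X 2 ^ 2 : MvPolynomial (Fin 3) R) := by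
  simp only [map_add, map_pow, map_mul, bind₁_X_right]
  simp only [Matrix.cons_val_zero, Matrix.cons_val_one, Matrix.cons_val_two, Matrix.tail_cons, Matrix.head_cons]
  ring

/-- [OURS · L1 W4.5b] Move `CAR`, chart `S.y/E1.y` (`X₀ ↦ X₀X₁`, exceptional `X₁`): `st1y(X₀X₁, X₁, X₂) = X₁ · st2yy`. [folklore] -/
theorem total_CAR_Sy_E1y : bind₁ (![X 0 * X 1, X 1, X 2] : Fin 3 → MvPolynomial (Fin 3) R) ((X 0 ^ 2 + X 1 * X 2 + X 1 * X 2 ^ 2 : MvPolynomial (Fin 3) R)) = X 1 * (X 0 ^ 2 * X 1 + X 2 + X 2 ^ 2 : MvPolynomial (Fin 3) R) := by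
  simp only [map_add, map_pow, map_mul, bind₁_X_right]
  simp only [Matrix.cons_val_zero, Matrix.cons_val_one, Matrix.cons_val_two, Matrix.tail_cons, Matrix.head_cons]
  ring

/-- [OURS · L1 W4.5b] Move `CAR`, chart `S.z/E1.x` (`X₂ ↦ X₂X₀`, exceptional `X₀`): `st1z(X₀, X₁, X₂X₀) = X₀ · st2zx`. [folklore] -/
theorem total_CAR_Sz_E1x : bind₁ (![X 0, X 1, X 2 * X 0] : Fin 3 → MvPolynomial (Fin 3) R) ((X 0 ^ 2 + X 1 ^ 2 * X 2 + X 1 * X 2 : MvPolynomial (Fin 3) R)) = X 0 * (X 0 + X 1 ^ 2 * X 2 + X 1 * X 2 : MvPolynomial (Fin 3) R) := by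
  simp only [map_add, map_pow, map_mul, bind₁_X_right]
  simp only [Matrix.cons_val_zero, Matrix.cons_val_one, Matrix.cons_val_two, Matrix.tail_cons, Matrix.head_cons]
  ring

/-- [OURS · L1 W4.5b] Move `CAR`, chart `S.z/E1.z` (`X₀ ↦ X₀X₂`, exceptional `X₂`): `st1z(X₀X₂, X₁, X₂) = X₂ · st2zz`. [folklore] -/
theorem total_CAR_Sz_E1z : bind₁ (![X 0 * X 2, X 1, X 2] : Fin 3 → MvPolynomial (Fin 3) R) ((X 0 ^ 2 + X 1 ^ 2 * X 2 + X 1 * X 2 : MvPolynomial (Fin 3) R)) = X 2 * (X 0 ^ 2 * X 2 + X 1 ^ 2 + X 1 : MvPolynomial (Fin 3) R) := by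
  simp only [map_add, map_pow, map_mul, bind₁_X_right]
  simp only [Matrix.cons_val_zero, Matrix.cons_val_one, Matrix.cons_val_two, Matrix.tail_cons, Matrix.head_cons]
  ring


/-! ## The MATURE host identities of the later moves (order A): `φ_q`, `σ_S`, `σ∗` lie on `St^k M♮` literally -/

/-- [OURS · L1 W4.5b] HOST identity at `φ_q`, chart `S.y/E1.x` (centre `φ_q = V(X₀, X₂)`, the fibre of `E₁ = V(X₀)` over `q`):
`st2yx = 1·X₀ + (X₁ + X₁X₂)·X₂ ∈ (X₀, X₂)` — order `1`, unit coefficient (no jump). [folklore] -/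
theorem host_PHI_E1x : (X 0 + X 1 * X 2 + X 1 * X 2 ^ 2 : MvPolynomial (Fin 3) R) = 1 * X 0 + (X 1 + X 1 * X 2) * X 2 := by
  ring

/-- [OURS · L1 W4.5b] Move `PHI` (pair round at `φ_q = V(X₀, X₂)`), chart `S.y/E1.x/Ephi.x` (`X₂ ↦ X₂X₀`, exceptional `E_φ = V(X₀)`):
`st2yx(X₀, X₁, X₂X₀) = X₀ · st3x`, `st3x = 1 + X₁X₂ + X₀X₁X₂²`. [folklore] -/
theorem total_PHI_E1x_Ephix : bind₁ (![X 0, X 1, X 2 * X 0] : Fin 3 → MvPolynomial (Fin 3) R)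
    ((X 0 + X 1 * X 2 + X 1 * X 2 ^ 2 : MvPolynomial (Fin 3) R)) = X 0 * (1 + X 1 * X 2 + X 0 * X 1 * X 2 ^ 2 : MvPolynomial (Fin 3) R) := by
  simp only [map_add, map_pow, map_mul, bind₁_X_right]
  simp only [Matrix.cons_val_zero, Matrix.cons_val_one, Matrix.cons_val_two, Matrix.tail_cons, Matrix.head_cons]
  ring

/-- [OURS · L1 W4.5b] Move `PHI`, chart `S.y/E1.x/Ephi.z` (`X₀ ↦ X₀X₂`, exceptional `E_φ = V(X₂)`): `st2yx(X₀X₂, X₁, X₂) = X₂ · st3z`,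
`st3z = X₀ + X₁ + X₁X₂`. [folklore] -/
theorem total_PHI_E1x_Ephiz : bind₁ (![X 0 * X 2, X 1, X 2] : Fin 3 → MvPolynomial (Fin 3) R)
    ((X 0 + X 1 * X 2 + X 1 * X 2 ^ 2 : MvPolynomial (Fin 3) R)) = X 2 * (X 0 + X 1 + X 1 * X 2 : MvPolynomial (Fin 3) R) := by
  simp only [map_add, map_pow, map_mul, bind₁_X_right]
  simp only [Matrix.cons_val_zero, Matrix.cons_val_one, Matrix.cons_val_two, Matrix.tail_cons, Matrix.head_cons]
  ring

/-- [OURS · L1 W4.5b] HOST identity at `σ_S`, chart `S.y/E1.x/Ephi.z` (centre `σ_S = St E₁ ∩ St S = V(X₀, X₁)`, `St E₁ = V(X₀)`,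
`St S = V(X₁)`): `st3z = 1·X₀ + (1 + X₂)·X₁ ∈ (X₀, X₁)` — unit coefficient. [folklore] -/
theorem host_SIG_Ephiz : (X 0 + X 1 + X 1 * X 2 : MvPolynomial (Fin 3) R) = 1 * X 0 + (1 + X 2) * X 1 := by
  ring

/-- [OURS · L1 W4.5b] PRESENTING identity at `σ∗`, chart `S.y/E1.x/Ephi.x` (centre `σ∗ = V(X₀, 1 + X₁X₂)`, `E_φ = V(X₀)`):
`st3x = 1·(1 + X₁X₂) + (X₁X₂²)·X₀`, so `(E_φ, St³M♮) = (X₀, 1 + X₁X₂) = σ∗` scheme-theoretically (the σ_S round of order A does not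
meet this chart, so the same identity serves `St⁴M♮`). [folklore] -/
theorem host_SST_Ephix : (1 + X 1 * X 2 + X 0 * X 1 * X 2 ^ 2 : MvPolynomial (Fin 3) R) = 1 * (1 + X 1 * X 2) + (X 1 * X 2 ^ 2) * X 0 := by
  ring

/-- [OURS · L1 W4.5b] The pair ideal at `σ∗`: `(X₀, st3x) = (X₀, 1 + X₁X₂)` as ideals of `R[X₀,X₁,X₂]`. [folklore] -/
theorem span_pair_SST_Ephix : Ideal.span {(X 0 : MvPolynomial (Fin 3) R), 1 + X 1 * X 2 + X 0 * X 1 * X 2 ^ 2} =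
    Ideal.span {(X 0 : MvPolynomial (Fin 3) R), 1 + X 1 * X 2} := by
  apply le_antisymm
  · rw [Ideal.span_le]
    rintro f hf
    rcases hf with rfl | rfl
    · exact Ideal.subset_span (by simp)
    · rw [host_SST_Ephix]
      exact Ideal.add_mem _ (Ideal.mul_mem_left _ _ (Ideal.subset_span (by simp)))
        (Ideal.mul_mem_left _ _ (Ideal.subset_span (by simp)))
  · rw [Ideal.span_le]
    rintro f hf
    rcases hf with rfl | rfl
    · exact Ideal.subset_span (by simp)
    · have hmem : (1 + X 1 * X 2 + X 0 * X 1 * X 2 ^ 2 : MvPolynomial (Fin 3) R) - (X 1 * X 2 ^ 2) * X 0 ∈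
          Ideal.span {(X 0 : MvPolynomial (Fin 3) R), 1 + X 1 * X 2 + X 0 * X 1 * X 2 ^ 2} :=
        Ideal.sub_mem _ (Ideal.subset_span (by simp)) (Ideal.mul_mem_left _ _ (Ideal.subset_span (by simp)))
      have h : (1 + X 1 * X 2 + X 0 * X 1 * X 2 ^ 2 : MvPolynomial (Fin 3) R) - (X 1 * X 2 ^ 2) * X 0 = 1 + X 1 * X 2 := by
        ring
      rwa [h] at hmem

/-! ## PROMOTION: every chart ring of `St²M♮` is regular (any base `R` with `R[X₀,X₁,X₂]` regular; every characteristic) -/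

/-- [OURS · L1 W4.5b] plumbing: the partial derivatives of `st2yx`, `st2zx`, `st1x` in `X₀`. [folklore] -/
theorem pderiv_zero_st2yx : pderiv 0 ((X 0 + X 1 * X 2 + X 1 * X 2 ^ 2 : MvPolynomial (Fin 3) R)) = 1 := by
  simp [Derivation.leibniz, Derivation.leibniz_pow, pderiv_X]

/-- [OURS · L1 W4.5b] plumbing. [folklore] -/
theorem pderiv_zero_st2zx : pderiv 0 ((X 0 + X 1 ^ 2 * X 2 + X 1 * X 2 : MvPolynomial (Fin 3) R)) = 1 := by
  simp [Derivation.leibniz, Derivation.leibniz_pow, pderiv_X]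

/-- [OURS · L1 W4.5b] plumbing: `∂₀ st1x = X₁²X₂ + X₁X₂²`. [folklore] -/
theorem pderiv_zero_st1x : pderiv 0 ((1 + X 0 * X 1 ^ 2 * X 2 + X 0 * X 1 * X 2 ^ 2 : MvPolynomial (Fin 3) R)) = X 1 ^ 2 * X 2 + X 1 * X 2 ^ 2 := by
  simp [Derivation.leibniz, Derivation.leibniz_pow, pderiv_X]
  ring

/-- [OURS · L1 W4.5b] plumbing: `∂₁ st2yy = X₀²`, `∂₂ st2yy = 1 + 2X₂`. [folklore] -/
theorem pderiv_one_st2yy : pderiv 1 ((X 0 ^ 2 * X 1 + X 2 + X 2 ^ 2 : MvPolynomial (Fin 3) R)) = X 0 ^ 2 := by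
  simp [Derivation.leibniz, Derivation.leibniz_pow, pderiv_X]

/-- [OURS · L1 W4.5b] plumbing. [folklore] -/
theorem pderiv_two_st2yy : pderiv 2 ((X 0 ^ 2 * X 1 + X 2 + X 2 ^ 2 : MvPolynomial (Fin 3) R)) = 1 + 2 * X 2 := by
  simp [Derivation.leibniz, Derivation.leibniz_pow, pderiv_X]

/-- [OURS · L1 W4.5b] plumbing: `∂₂ st2zz = X₀²` (and below `∂₁ st2zz = 2X₁ + 1`). [folklore] -/
theorem pderiv_two_st2zz : pderiv 2 ((X 0 ^ 2 * X 2 + X 1 ^ 2 + X 1 : MvPolynomial (Fin 3) R)) = X 0 ^ 2 := by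
  simp [Derivation.leibniz, Derivation.leibniz_pow, pderiv_X]

/-- [OURS · L1 W4.5b] plumbing. [folklore] -/
theorem pderiv_one_st2zz : pderiv 1 ((X 0 ^ 2 * X 2 + X 1 ^ 2 + X 1 : MvPolynomial (Fin 3) R)) = 2 * X 1 + 1 := by
  simp [Derivation.leibniz, Derivation.leibniz_pow, pderiv_X]

section Regular

variable [IsRegularRing (MvPolynomial (Fin 3) R)]

/-- [OURS · L1 W4.5b] **PROMOTION, chart `S.y/E1.x`**: `R[X]/(X₀ + X₁X₂ + X₁X₂²)` is a regular ring (`∂₀ = 1`).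
[cite: Matsumura1987, Thm. 14.2] -/
theorem isRegularRing_st2yx : IsRegularRing (MvPolynomial (Fin 3) R ⧸ Ideal.span {(X 0 + X 1 * X 2 + X 1 * X 2 ^ 2 : MvPolynomial (Fin 3) R)}) := by
  refine Theorems.MvPolynomial.isRegularRing_quotient_of_pderiv fun Q hQ _ => ⟨0, fun h => ?_⟩
  rw [pderiv_zero_st2yx] at h
  exact hQ.ne_top ((Ideal.eq_top_iff_one Q).mpr h)

/-- [OURS · L1 W4.5b] **PROMOTION, chart `S.z/E1.x`**: `R[X]/(X₀ + X₁²X₂ + X₁X₂)` is a regular ring (`∂₀ = 1`).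
[cite: Matsumura1987, Thm. 14.2] -/
theorem isRegularRing_st2zx : IsRegularRing (MvPolynomial (Fin 3) R ⧸ Ideal.span {(X 0 + X 1 ^ 2 * X 2 + X 1 * X 2 : MvPolynomial (Fin 3) R)}) := by
  refine Theorems.MvPolynomial.isRegularRing_quotient_of_pderiv fun Q hQ _ => ⟨0, fun h => ?_⟩
  rw [pderiv_zero_st2zx] at h
  exact hQ.ne_top ((Ideal.eq_top_iff_one Q).mpr h)

/-- [OURS · L1 W4.5b] **PROMOTION, chart `S.y/E1.y`**: `R[X]/(X₀²X₁ + X₂ + X₂²)` is a regular ring, in EVERY characteristic: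
`(1 + 2X₂)·∂₂ − 4·st2yy + 4X₁·∂₁ = 1`, so no prime contains `st2yy`, `∂₁ st2yy`, `∂₂ st2yy` together.
[cite: Matsumura1987, Thm. 14.2] -/
theorem isRegularRing_st2yy : IsRegularRing (MvPolynomial (Fin 3) R ⧸ Ideal.span {(X 0 ^ 2 * X 1 + X 2 + X 2 ^ 2 : MvPolynomial (Fin 3) R)}) := by
  refine Theorems.MvPolynomial.isRegularRing_quotient_of_pderiv fun Q hQ hF => ?_
  by_contra hall
  push Not at hall
  have h1 : pderiv 1 ((X 0 ^ 2 * X 1 + X 2 + X 2 ^ 2 : MvPolynomial (Fin 3) R)) ∈ Q := hall 1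
  have h2 : pderiv 2 ((X 0 ^ 2 * X 1 + X 2 + X 2 ^ 2 : MvPolynomial (Fin 3) R)) ∈ Q := hall 2
  rw [pderiv_one_st2yy] at h1
  rw [pderiv_two_st2yy] at h2
  have key : (1 + 2 * X 2) * (1 + 2 * X 2) - 4 * (X 0 ^ 2 * X 1 + X 2 + X 2 ^ 2 : MvPolynomial (Fin 3) R) + 4 * X 1 * X 0 ^ 2 = (1 : MvPolynomial (Fin 3) R) := by
    ring
  have hmem : (1 + 2 * X 2) * (1 + 2 * X 2) - 4 * (X 0 ^ 2 * X 1 + X 2 + X 2 ^ 2 : MvPolynomial (Fin 3) R) + 4 * X 1 * X 0 ^ 2 ∈ Q :=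
    Q.add_mem (Q.sub_mem (Q.mul_mem_left _ h2) (Q.mul_mem_left _ hF)) (Q.mul_mem_left _ h1)
  rw [key] at hmem
  exact hQ.ne_top ((Ideal.eq_top_iff_one Q).mpr hmem)

/-- [OURS · L1 W4.5b] **PROMOTION, chart `S.z/E1.z`**: `R[X]/(X₀²X₂ + X₁² + X₁)` is a regular ring, in EVERY characteristic:
`(1 + 2X₁)·∂₁ − 4·st2zz + 4X₂·∂₂ = 1`. [cite: Matsumura1987, Thm. 14.2] -/
theorem isRegularRing_st2zz : IsRegularRing (MvPolynomial (Fin 3) R ⧸ Ideal.span {(X 0 ^ 2 * X 2 + X 1 ^ 2 + X 1 : MvPolynomial (Fin 3) R)}) := by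
  refine Theorems.MvPolynomial.isRegularRing_quotient_of_pderiv fun Q hQ hF => ?_
  by_contra hall
  push Not at hall
  have h1 : pderiv 1 ((X 0 ^ 2 * X 2 + X 1 ^ 2 + X 1 : MvPolynomial (Fin 3) R)) ∈ Q := hall 1
  have h2 : pderiv 2 ((X 0 ^ 2 * X 2 + X 1 ^ 2 + X 1 : MvPolynomial (Fin 3) R)) ∈ Q := hall 2
  rw [pderiv_one_st2zz] at h1
  rw [pderiv_two_st2zz] at h2
  have key : (2 * X 1 + 1) * (2 * X 1 + 1) - 4 * (X 0 ^ 2 * X 2 + X 1 ^ 2 + X 1 : MvPolynomial (Fin 3) R) + 4 * X 2 * X 0 ^ 2 = (1 : MvPolynomial (Fin 3) R) := by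
    ring
  have hmem : (2 * X 1 + 1) * (2 * X 1 + 1) - 4 * (X 0 ^ 2 * X 2 + X 1 ^ 2 + X 1 : MvPolynomial (Fin 3) R) + 4 * X 2 * X 0 ^ 2 ∈ Q :=
    Q.add_mem (Q.sub_mem (Q.mul_mem_left _ h1) (Q.mul_mem_left _ hF)) (Q.mul_mem_left _ h2)
  rw [key] at hmem
  exact hQ.ne_top ((Ideal.eq_top_iff_one Q).mpr hmem)

/-- [OURS · L1 W4.5b] **The far chart `S.x`** (not met by the carrier; `St²M♮ = St¹M♮` there): `R[X]/(1 + X₀X₁²X₂ + X₀X₁X₂²)`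
is a regular ring — `st1x − X₀·∂₀ st1x = 1`. [cite: Matsumura1987, Thm. 14.2] -/
theorem isRegularRing_st1x : IsRegularRing (MvPolynomial (Fin 3) R ⧸ Ideal.span {(1 + X 0 * X 1 ^ 2 * X 2 + X 0 * X 1 * X 2 ^ 2 : MvPolynomial (Fin 3) R)}) := by
  refine Theorems.MvPolynomial.isRegularRing_quotient_of_pderiv fun Q hQ hF => ⟨0, fun h0 => ?_⟩
  rw [pderiv_zero_st1x] at h0
  have key : (1 + X 0 * X 1 ^ 2 * X 2 + X 0 * X 1 * X 2 ^ 2 : MvPolynomial (Fin 3) R) - X 0 * (X 1 ^ 2 * X 2 + X 1 * X 2 ^ 2) = (1 : MvPolynomial (Fin 3) R) := by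
    ring
  have hmem : (1 + X 0 * X 1 ^ 2 * X 2 + X 0 * X 1 * X 2 ^ 2 : MvPolynomial (Fin 3) R) - X 0 * (X 1 ^ 2 * X 2 + X 1 * X 2 ^ 2) ∈ Q := Q.sub_mem hF (Q.mul_mem_left _ h0)
  rw [key] at hmem
  exact hQ.ne_top ((Ideal.eq_top_iff_one Q).mpr hmem)

end Regular

/-! ## Instances of use: the special fibre (`k` a field) and the model (`O` a discrete valuation ring) -/

/-- [OURS · L1 W4.5b] Over a FIELD `k` of any characteristic all five chart rings of `St²M♮` are regular. [cite: Matsumura1987, Thm. 14.2] -/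
theorem isRegularRing_charts_field (k : Type) [Field k] :
    IsRegularRing (MvPolynomial (Fin 3) k ⧸ Ideal.span {(X 0 + X 1 * X 2 + X 1 * X 2 ^ 2 : MvPolynomial (Fin 3) k)}) ∧ IsRegularRing (MvPolynomial (Fin 3) k ⧸ Ideal.span {(X 0 ^ 2 * X 1 + X 2 + X 2 ^ 2 : MvPolynomial (Fin 3) k)}) ∧
    IsRegularRing (MvPolynomial (Fin 3) k ⧸ Ideal.span {(X 0 + X 1 ^ 2 * X 2 + X 1 * X 2 : MvPolynomial (Fin 3) k)}) ∧ IsRegularRing (MvPolynomial (Fin 3) k ⧸ Ideal.span {(X 0 ^ 2 * X 2 + X 1 ^ 2 + X 1 : MvPolynomial (Fin 3) k)}) ∧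
    IsRegularRing (MvPolynomial (Fin 3) k ⧸ Ideal.span {(1 + X 0 * X 1 ^ 2 * X 2 + X 0 * X 1 * X 2 ^ 2 : MvPolynomial (Fin 3) k)}) :=
  ⟨isRegularRing_st2yx k, isRegularRing_st2yy k, isRegularRing_st2zx k, isRegularRing_st2zz k, isRegularRing_st1x k⟩

/-- [OURS · L1 W4.5b] Over a DISCRETE VALUATION RING `O` (the model side; `O[X]` regular by Mathlib's
`MvPolynomial.isRegularRing_of_isRegularRing`) all five chart rings of the model `St²M♮_O` (same equations,
`map_keyLetterNat`) are regular. [cite: Matsumura1987, Thm. 14.2] -/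
theorem isRegularRing_charts_dvr (O : Type) [CommRing O] [IsDomain O] [IsDiscreteValuationRing O] :
    IsRegularRing (MvPolynomial (Fin 3) O ⧸ Ideal.span {(X 0 + X 1 * X 2 + X 1 * X 2 ^ 2 : MvPolynomial (Fin 3) O)}) ∧ IsRegularRing (MvPolynomial (Fin 3) O ⧸ Ideal.span {(X 0 ^ 2 * X 1 + X 2 + X 2 ^ 2 : MvPolynomial (Fin 3) O)}) ∧
    IsRegularRing (MvPolynomial (Fin 3) O ⧸ Ideal.span {(X 0 + X 1 ^ 2 * X 2 + X 1 * X 2 : MvPolynomial (Fin 3) O)}) ∧ IsRegularRing (MvPolynomial (Fin 3) O ⧸ Ideal.span {(X 0 ^ 2 * X 2 + X 1 ^ 2 + X 1 : MvPolynomial (Fin 3) O)}) ∧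
    IsRegularRing (MvPolynomial (Fin 3) O ⧸ Ideal.span {(1 + X 0 * X 1 ^ 2 * X 2 + X 0 * X 1 * X 2 ^ 2 : MvPolynomial (Fin 3) O)}) :=
  ⟨isRegularRing_st2yx O, isRegularRing_st2yy O, isRegularRing_st2zx O, isRegularRing_st2zz O, isRegularRing_st1x O⟩


/-! ## APPENDIX (append 1, res-L1-w45b-lead-1 g16): the projective letter `V₊(X²W + Y²Z + YZ²) ⊂ ℙ³` at INFINITY — regular on the three
charts `X = 1`, `Y = 1`, `Z = 1` (untouched by the word, which lives over `W = 1`), so that after PROMOTION the whole projective model `St²M♮_O ⊂ Bl ℙ³_O` is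
covered by regular affine charts: the five blow-up charts above + these three.  Two of them are LITERALLY the polynomials `st2yy`, `st2zz` (chart `Y = 1`:
`x²w + z + z²` = `st2yy` in the variables `(x, w, z)`; chart `Z = 1`: `x²w + y² + y` = `st2zz` in `(x, y, w)`), so `isRegularRing_st2yy/_st2zz` serve verbatim;
the chart `X = 1` is `w + y²z + yz²`, linear in `w`. -/

/-- [OURS · L1 W4.5b] plumbing: `∂₀ (X₀ + X₁²X₂ + X₁X₂²) = 1`. [folklore] -/
theorem pderiv_zero_inftyX : pderiv 0 ((X 0 + X 1 ^ 2 * X 2 + X 1 * X 2 ^ 2 : MvPolynomial (Fin 3) R)) = 1 := by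
  simp [Derivation.leibniz, Derivation.leibniz_pow, pderiv_X]

/-- [OURS · L1 W4.5b] **The chart `X = 1` at infinity of the projective key letter**: `R[X]/(X₀ + X₁²X₂ + X₁X₂²)` (`X₀ = w, X₁ = y, X₂ = z`) is a regular ring
for every base with `R[X]` regular (`∂₀ = 1`). Together with `isRegularRing_st2yy` (chart `Y = 1`: `x²w + z + z²`) and `isRegularRing_st2zz` (chart `Z = 1`:
`x²w + y² + y`) this covers `V₊(X²W + Y²Z + YZ²) ∖ {W ≠ 0}`; in particular the projective letter is regular off `x₀ = (0:0:0:1)` in every characteristic.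
[cite: Matsumura1987, Thm. 14.2] -/
theorem isRegularRing_inftyX [IsRegularRing (MvPolynomial (Fin 3) R)] :
    IsRegularRing (MvPolynomial (Fin 3) R ⧸ Ideal.span {(X 0 + X 1 ^ 2 * X 2 + X 1 * X 2 ^ 2 : MvPolynomial (Fin 3) R)}) := by
  refine Theorems.MvPolynomial.isRegularRing_quotient_of_pderiv fun Q hQ _ => ⟨0, fun h => ?_⟩
  rw [pderiv_zero_inftyX] at h
  exact hQ.ne_top ((Ideal.eq_top_iff_one Q).mpr h)

/-- [OURS · L1 W4.5b] Dehomogenisation identities of the projective key letter `F = X₀²X₃ + X₁²X₂ + X₁X₂²` (`(X₀,X₁,X₂,X₃) = (X,Y,Z,W)`): on `W = 1` it is the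
affine letter `m`, on `X = 1`, `Y = 1`, `Z = 1` the three charts at infinity named above (pure evaluation identities over any `CommRing`). [folklore] -/
theorem dehomog_keyLetter_charts :
    (aeval (![X 0, X 1, X 2, 1] : Fin 4 → MvPolynomial (Fin 3) R) (X 0 ^ 2 * X 3 + X 1 ^ 2 * X 2 + X 1 * X 2 ^ 2 : MvPolynomial (Fin 4) R)
        = X 0 ^ 2 + X 1 ^ 2 * X 2 + X 1 * X 2 ^ 2) ∧
    (aeval (![1, X 1, X 2, X 0] : Fin 4 → MvPolynomial (Fin 3) R) (X 0 ^ 2 * X 3 + X 1 ^ 2 * X 2 + X 1 * X 2 ^ 2 : MvPolynomial (Fin 4) R)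
        = X 0 + X 1 ^ 2 * X 2 + X 1 * X 2 ^ 2) ∧
    (aeval (![X 0, 1, X 2, X 1] : Fin 4 → MvPolynomial (Fin 3) R) (X 0 ^ 2 * X 3 + X 1 ^ 2 * X 2 + X 1 * X 2 ^ 2 : MvPolynomial (Fin 4) R)
        = X 0 ^ 2 * X 1 + X 2 + X 2 ^ 2) ∧
    (aeval (![X 0, X 1, 1, X 2] : Fin 4 → MvPolynomial (Fin 3) R) (X 0 ^ 2 * X 3 + X 1 ^ 2 * X 2 + X 1 * X 2 ^ 2 : MvPolynomial (Fin 4) R)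
        = X 0 ^ 2 * X 2 + X 1 ^ 2 + X 1) := by
  refine ⟨?_, ?_, ?_, ?_⟩ <;>
  · simp only [map_add, map_mul, map_pow, aeval_X]
    simp only [Matrix.cons_val_zero, Matrix.cons_val_one, Matrix.cons_val_two, Matrix.cons_val_three, Matrix.tail_cons, Matrix.head_cons]
    ring

end S10KeyLetter

end Summit.ResolutionOfSingularities.ResolutionOfSingularities.Cruxes.EquisingularLiftNat.Sections
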